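import Mathlib
import Literature.MathematicalPhysics.QuantumFieldTheory.CurvatureGaussianField
import Literature.MathematicalPhysics.QuantumLattice.LatticeScalarField

/-!
# BC5 rung for `StaticSourceResponse` (SSW X₁) — Part B lattice layer: the dipole-energy
# hyperscaling floor in lattice Maxwell theory (`curvatureGaussianField 4 1`) — DISCHARGED (v3)

**v3 (2026-08-28, seat `ym-mirror-bc5w-1-g2`): the former plan-only stub of this file,
`stub_rung_dipoleEnergyFloor` (= `Rung.DipoleEnergyFloor`), is PROVED in `Lines/rung.lean` Part C as
`Rung.dipoleEnergyFloor` (crux write commit 90623342ef7c; `lean check` rc 0, 0 sorry, axioms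
propext / Classical.choice / Quot.sound), and X₁'s lattice-Maxwell instance
`Rung.latticeMaxwell_staticSourceResponse` is now UNCONDITIONAL.  This file keeps the statement as a
`def` (crux workfiles are not importable modules, so it cannot cite the proof by name) and the record
of the plan; it contains NO `sorry`.  The proof used exactly the planned technique — Lawler (1.37)
second-difference asymptotics of the `ℤ⁴` Green function (tree
`Literature.Probability.LatticeModels.latticeGreen_second_diff_continuum`) with the tree's closed
form of the parallel-plaquette curvature kernel (`WeakCouplingRates.curvatureTwoPoint_eq_curl_greenTensor`,
`curl_greenTensor_parallel`) — in a hyperscaling configuration (`N × N` source, `N = ⌊ℓ/(64a)⌋`;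
probe bump `≡ 1` on a `(2N+1)⁴`-site box at distance `≍ N`; kernel `≥ 1/(4π²|z|⁴)` on the cone
`4(z₁²+z₂²) ≤ |z|²`), with `c₁ = 1/(16 π⁴ 16650⁴)` and `a₀ = ℓ/(128 R₀)`; no Riemann-sum limit was
needed (a pointwise cone floor suffices).**

(v2 text, kept for the record:)
Companion of `Lines/rung.lean`, which LANDS (sorry-free): (A) the Gaussian static-source identity
`Cov(cos U, V²) = −E[cos U]·Cov(U,V)²` (★) for ANY centred Gaussian pair on a probability space
(`Rung.gaussianPair_staticSource_identity`, via `IsGaussian.ext_covarianceBilinDual`) and its ratio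
floor; (B) its application to the tree's lattice Maxwell field `μ = curvatureGaussianField 4 1`
(`Φ_rect := ∑_{p ∈ rect} Y_p` the abelian holonomy angle of the mirror rectangle by lattice Stokes,
`Y_q = ω q 0`, `Cov(Φ_rect, Y_q) = dipoleField rect q` = `Rung.cov_holonomy_plaquette`), giving EXACTLY

  `Cov_μ(cos Φ_rect, Ṽ_v) = −E_μ[cos Φ_rect] · dipoleEnergy a v rect L`   (`Rung.latticeMaxwell_probe_response`),
  `E_μ[cos Φ_rect] = e^{−Var Φ_rect/2} > 0`                              (`Rung.latticeMaxwell_wLoop_eq/_pos`),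

with `Ṽ_v = ∑_y v(a y) ∑_{q at y} Y_q²` the probe of X₁ (plaquette energies = the abelian `dens`);
and (C) the composition `Rung.latticeMaxwell_staticSourceResponse_of_floor :
Rung.DipoleEnergyFloor → (X₁'s lattice-Maxwell instance in RATIO form: per window a probe, c₁ > 0
uniform in the spacing a ≤ a₀ and the volume L, a mirror rectangle in {y₀ < 0}, and
0 < E[w] ∧ c₁·E[w] ≤ |Cov(w, Ṽ_v)|)`.  So the ONLY open input of the lattice rung is the purely
deterministic lattice-potential-theory floor `stub_rung_dipoleEnergyFloor` below — literally
`Rung.DipoleEnergyFloor` (the definitions in this file are verbatim copies of those of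
`Lines/rung.lean` §B, duplicated only because crux workfiles are not built as importable modules);
the classical field energy of the static source inside the probe is bounded below uniformly in `a`:
hyperscaling saturates — `dipoleField ~ n²·n⁻⁴`, `#probe sites ~ n⁴`, `n = ℓ/a`.

Technique that should prove the stub: lattice Green-function asymptotics with second-difference
control, `G(x) = a_d|x|^{2−d} + O(|x|^{−d})`, `∇_y² G(x) − a_d|y|² D_{uu}|x|^{2−d} = O(|x|^{−d−1})`
[corpus: book:lawler1991-intersections-random-walks p.21, Theorems 1.5.4–1.5.5], giving
`curvatureTwoPoint p q → ` the continuum Maxwell two-form kernel at macroscopic separation, then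
Riemann-sum convergence of `dipoleEnergy` to the (positive, finite) continuum dipole energy
`∫ v(y) ∑_{μν} (∫_Σ ⟨F_Σ F_{μν}(y)⟩)² dy`; `c₁ :=` half of it.

Why this is a T3 witness and not S: the model is free and abelian; S's (`NT`'s) clause (ii) is
FALSE there (`Lines/rung.lean: freeAbelian_NT_clauseII_false`, tree `maxwellRing3_eq_zero`), while
X₁'s analogue holds — and it exercises exactly X₁'s lever (the `E[w]`-normalised response is `O(1)`
although `E[w] = e^{−Var Φ_rect/2}` is perimeter-small, `Var Φ_rect ≍ |∂rect|` in lattice units).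

NOTHING HERE PROVES the Yang–Mills mass gap, `NT`, or any item of the route.  (v3: no `sorry` left.)
-/

open Literature.Probability.LatticeModels Literature.MathematicalPhysics.QuantumLattice
  Literature.MathematicalPhysics.QuantumFieldTheory

noncomputable section

namespace Summit.QuantumFields.YangMills.Cruxes.StaticSourceResponse.RungPlan

/-- Euclidean `ℝ⁴`. [folklore] -/
abbrev E4 := EuclideanSpace ℝ (Fin 4)

/-- An oriented coordinate plane `i < j` of `ℤ⁴`. [folklore] -/
abbrev Plane := {p : Fin 4 × Fin 4 // p.1 < p.2}

/-- The plaquettes of the `R × T` rectangle based at `x` in the plane `ij`: `(x + m eᵢ + n eⱼ; i, j)`,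
`0 ≤ m < R`, `0 ≤ n < T` (a spanning surface of the rectangular Wilson loop; lattice Stokes makes
the abelian holonomy angle the sum of their curvatures). [folklore] -/
def rectPlaq (x : Site 4) (ij : Plane) (R T : ℕ) : Finset (ZdPlaquette 4) :=
  (Finset.range R ×ˢ Finset.range T).image
    fun mn => (x + (mn.1 : ℤ) • Pi.single ij.1.1 1 + (mn.2 : ℤ) • Pi.single ij.1.2 1, ij)

/-- The classical (linear-response) field of the static source `rect` at the plaquette `q`:
`Cov_μ(Φ_rect, Y_q) = ∑_{p ∈ rect} (dGd*)(p, q)`. [this route] -/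
def dipoleField (rect : Finset (ZdPlaquette 4)) (q : ZdPlaquette 4) : ℝ :=
  ∑ p ∈ rect, curvatureTwoPoint p q

open MeasureTheory ProbabilityTheory in
/-- **Lattice linear response (LANDED)**: under the lattice Maxwell field
`μ = curvatureGaussianField 4 1` the covariance of the abelian holonomy angle of the source,
`Φ_rect = ∑_{p ∈ rect} Y_p` (lattice Stokes), with a plaquette curvature `Y_q` is the classical
dipole field `dipoleField rect q = ∑_{p ∈ rect} (dGd*)(p, q)` — the quantity whose probe-weighted
square energy the stub below bounds from below. [this route] -/
theorem cov_holonomy_plaquette (rect : Finset (ZdPlaquette 4)) (q : ZdPlaquette 4) :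
    cov[fun ω => ∑ p ∈ rect, ω p 0, fun ω => ω q 0; curvatureGaussianField 4 1]
      = dipoleField rect q := by
  have hd : 3 ≤ 4 := by norm_num
  haveI : IsProbabilityMeasure (curvatureGaussianField 4 1) :=
    isProbabilityMeasure_curvatureGaussianField hd 1
  have hG := isGaussianProcess_eval_curvatureGaussianField hd 1
  have hmem : ∀ p : ZdPlaquette 4,
      MemLp (fun ω : ZdPlaquette 4 → Fin 1 → ℝ => ω p 0) 2 (curvatureGaussianField 4 1) :=
    fun p => (hG.hasGaussianLaw_eval (p, 0)).memLp_two
  rw [covariance_fun_sum_left' (fun p _ => hmem p) (hmem q), dipoleField]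
  refine Finset.sum_congr rfl fun p _ => ?_
  rw [covariance_eval_curvatureGaussianField hd 1 p q 0 0, if_pos rfl]

/-- The six plaquettes based at the site `y`. [folklore] -/
def plaqAt (y : Site 4) : Finset (ZdPlaquette 4) :=
  (Finset.univ : Finset Plane).image fun ij => (y, ij)

/-- The sites of the cube `[-L, L]⁴`. [folklore] -/
def cube (L : ℕ) : Finset (Site 4) :=
  Fintype.piFinset fun _ : Fin 4 => Finset.Icc (-(L : ℤ)) L

/-- The probe-weighted dipole energy at lattice spacing `a`:
`∑_y v(a y) ∑_{q at y} Cov(Φ_rect, Y_q)²` — by (★) this is `|Cov(cos Φ_rect, Ṽ_v)| / E[cos Φ_rect]`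
exactly. [this route] -/
def dipoleEnergy (a : ℝ) (v : E4 → ℝ) (rect : Finset (ZdPlaquette 4)) (L : ℕ) : ℝ :=
  ∑ y ∈ cube L, v (a • siteToE y) * ∑ q ∈ plaqAt y, dipoleField rect q ^ 2

/-- For a non-negative probe the dipole energy is non-negative (so the ratio floor is a floor on a
positive quantity, with no cancellations to fight). [this route] -/
theorem dipoleEnergy_nonneg {a : ℝ} {v : E4 → ℝ} (hv : ∀ z, 0 ≤ v z) (rect : Finset (ZdPlaquette 4))
    (L : ℕ) : 0 ≤ dipoleEnergy a v rect L :=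
  Finset.sum_nonneg fun _ _ => mul_nonneg (hv _) (Finset.sum_nonneg fun _ _ => sq_nonneg _)

/-- **DISCHARGED stub (was the PLAN-ONLY BC5 rung, lattice layer): the dipole-energy hyperscaling
floor.**  For every window `ℓ` there are a probe `v` (Schwartz, `0 ≤ v`, supported in
`{y₀ > 0} ∩ B̄(0, ℓ)`, `v ≠ 0`), a constant `c₁ > 0` and `a₀ > 0` such that for every spacing `a ≤ a₀`
and every volume `L` with `ℓ ≤ a L` some mirror rectangle (in a coordinate plane, strictly inside
`{y₀ < 0}`, within physical distance `ℓ` of the origin) has probe-weighted classical field energy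
`≥ c₁`.  This is VERBATIM `Rung.DipoleEnergyFloor` of `Lines/rung.lean`, PROVED there (v3, Part C) as
`Rung.dipoleEnergyFloor`; by `Rung.latticeMaxwell_staticSourceResponse_of_floor` it yields X₁'s
instance in the lattice Maxwell theory `curvatureGaussianField 4 1` — now the unconditional theorem
`Rung.latticeMaxwell_staticSourceResponse`: `0 < E[cos Φ_rect]` and
`c₁ · E[cos Φ_rect] ≤ |Cov(cos Φ_rect, Ṽ_v)|`, `c₁` uniform in `a ≤ a₀` and `L`.  Kept as a `def` only
(this file cannot import the crux workfile that proves it). [this route] -/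
def StubRungDipoleEnergyFloor : Prop :=
    ∀ ℓ : ℝ, 0 < ℓ → ∃ (v : SchwartzMap E4 ℝ) (c₁ a₀ : ℝ),
      tsupport (v : E4 → ℝ) ⊆ {y | 0 < y 0} ∧ tsupport (v : E4 → ℝ) ⊆ Metric.closedBall 0 ℓ ∧
      (v : E4 → ℝ) ≠ 0 ∧ (∀ z, 0 ≤ v z) ∧ 0 < c₁ ∧ 0 < a₀ ∧
      ∀ a : ℝ, 0 < a → a ≤ a₀ → ∀ L : ℕ, ℓ ≤ a * L →
        ∃ (x : Site 4) (ij : Plane) (R T : ℕ), 1 ≤ R ∧ 1 ≤ T ∧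
          ((x 0 : ℤ) + R + T ≤ -1) ∧ (-ℓ ≤ a * (x 0 : ℝ)) ∧ (∀ k, |(x k : ℝ)| * a ≤ ℓ) ∧
          c₁ ≤ dipoleEnergy a (v : E4 → ℝ) (rectPlaq x ij R T) L

end Summit.QuantumFields.YangMills.Cruxes.StaticSourceResponse.RungPlan

end
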